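import Summits.RiemannHypothesis.RiemannHypothesis.Theses.ScrewLemmaKExtremalRay
import HarnessLib

/-!
# Route ScrewLemmaKExtremalRay (L24 «EXTREMAL RAY») — `Assembly` (stmt-RiemannHypothesis-22264)

`NearExtremalGenerators → CoprofileIsometry → CoprofileMoments → ThresholdRoom → ScrewSmoothSectorKOptimal`
(`∀ K > π² − 1, ¬ SmoothSectorKInequality K`): given `K > π² − 1`, `ThresholdRoom` supplies `ε` with
`π²(1/6+ε)² < 36(K+1)(1/36−ε)²`; a near-extremal generator `g` (`∫Φ² ≤ (1/6+ε)²`, `∫Φ ≥ 1/36 − ε`) fed through the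
isometry `4π²(X + c²) = ∫Φ²`, the first moment `∫Φ = (π²/3)c` and the assumed inequality `K c² ≤ X` gives
`36(K+1)(1/36−ε)² ≤ π²(1/6+ε)²` — contradiction. This is the planner's kernel-checked `assembly_proof` (rh-idea-5
g0, pub/ideators/rh-idea-5/Sketch3.lean sha16 8c4f43109474fb4e, over local copies of the same decls), written
against the route decls. RH-free real analysis; the route's cruxes stay OPEN (and its target awaits the alt-closer
load); no summit is proved by this; nothing here bears on the truth of RH.
-/

-- D-0017: `Summit.RiemannHypothesis.RiemannHypothesis.…` duplicates the namespace BY DESIGN (single-problem summit).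
set_option linter.dupNamespace false

namespace Summit.RiemannHypothesis.RiemannHypothesis.Theorems.ScrewLemmaKExtremalRay

/-- **`Assembly` (item stmt-RiemannHypothesis-22264) holds**: threshold room + near-extremal generator +
isometry + first moment contradict `SmoothSectorKInequality K` for `K > π² − 1` (planner rh-idea-5's
`assembly_proof`, 8c4f4310, verbatim). RH-free. -/
theorem assembly_proof :
    Summit.RiemannHypothesis.RiemannHypothesis.Theses.ScrewLemmaKExtremalRay.Assembly := by
  intro h1 h2 h3 h4 K hK hS
  obtain ⟨ε, hε0, hε1, hroom⟩ := h4 K hK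
  obtain ⟨g, hg, hint, hP, hm⟩ := h1 ε hε0
  have hI := h2 g hg hint
  obtain ⟨-, hm0, -, -⟩ := h3 g hg
  have hKin := hS g hg hint
  set X := (∫ y in Set.Ioo (0:ℝ) 1,
    (Summit.RiemannHypothesis.RiemannHypothesis.Theorems.IntegerScrew.latticeProfile g y -
      Summit.RiemannHypothesis.RiemannHypothesis.Theorems.IntegerScrew.latticePlateau g) ^ 2 / y ^ 2) with hX
  set P := (∫ t in Set.Ioo (0:ℝ) 1, (∑ n ∈ Finset.Icc 1 ⌊1 / t⌋₊, deriv g (n * t) / n) ^ 2) with hP'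
  set m := (∫ t in Set.Ioo (0:ℝ) 1, ∑ n ∈ Finset.Icc 1 ⌊1 / t⌋₊, deriv g (n * t) / n) with hm'
  set c := Summit.RiemannHypothesis.RiemannHypothesis.Theorems.IntegerScrew.latticePlateau g with hc
  have hpi : 0 < Real.pi ^ 2 := by positivity
  have hpi3 : (9.8 : ℝ) < Real.pi ^ 2 := by
    have := Real.pi_gt_d2; nlinarith
  -- from the isometry: 4π²(X + c²) = P
  have h4 : 4 * Real.pi ^ 2 * (X + c ^ 2) = P := by rw [hI]; field_simp
  -- K c² ≤ X  ⇒ 4π²(K+1)c² ≤ P ≤ (1/6+ε)²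
  have hK1 : 0 < K + 1 := by linarith
  have h5 : 4 * Real.pi ^ 2 * (K + 1) * c ^ 2 ≤ (1 / 6 + ε) ^ 2 := by nlinarith
  -- c = (3/π²) m ≥ (3/π²)(1/36 − ε) > 0
  have hcm : c = 3 / Real.pi ^ 2 * m := by
    field_simp; linarith [hm0]
  have hmpos : 0 < 1 / 36 - ε := by linarith
  have hc_lb : 3 / Real.pi ^ 2 * (1 / 36 - ε) ≤ c := by
    rw [hcm]; exact mul_le_mul_of_nonneg_left hm (by positivity)
  have hc_pos : 0 < c := lt_of_lt_of_le (by positivity) hc_lb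
  have h6 : (3 / Real.pi ^ 2 * (1 / 36 - ε)) ^ 2 ≤ c ^ 2 :=
    pow_le_pow_left₀ (by positivity) hc_lb 2
  -- combine: 4π²(K+1)·(9/π⁴)(1/36−ε)² ≤ (1/6+ε)², i.e. 36(K+1)(1/36−ε)² ≤ π²(1/6+ε)² — contradiction
  have h7 : 4 * Real.pi ^ 2 * (K + 1) * (3 / Real.pi ^ 2 * (1 / 36 - ε)) ^ 2 ≤ (1 / 6 + ε) ^ 2 :=
    le_trans (by
      have : 0 ≤ 4 * Real.pi ^ 2 * (K + 1) := by positivity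
      exact mul_le_mul_of_nonneg_left h6 this) h5
  have h8 : 4 * Real.pi ^ 2 * (K + 1) * (3 / Real.pi ^ 2 * (1 / 36 - ε)) ^ 2
      = 36 * (K + 1) * (1 / 36 - ε) ^ 2 / Real.pi ^ 2 := by
    field_simp; ring
  rw [h8, div_le_iff₀ hpi] at h7
  linarith [hroom]

end Summit.RiemannHypothesis.RiemannHypothesis.Theorems.ScrewLemmaKExtremalRay
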